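import Literature.MathematicalPhysics.QuantumManyBody.JelliumBoxCutoffMonotone
import HarnessLib

/-!
# Elementary bounds on the cut-off kernel `V_{r,R}` of Lieb–Solovej

Topic `Literature/MathematicalPhysics/QuantumManyBody` (the charged Bose gas, `JelliumBoseGas.foldyLaw`).
The facts about `V_{r,R} = Y_{R⁻¹} - Y_{r⁻¹}` and `w_{r,R}(x,y) = χ_ℓ(x)V_{r,R}(x-y)χ_ℓ(y)` quoted without
proof in [LiebSolovej2001, §4–§5 and §9]:

* `cutoffKernel_le_inv_sub_inv` — "for `x ≪ r`, `V_{r,R}(x) ≈ r⁻¹ - R⁻¹`": the pointwise bound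
  `V_{r,R} ≤ r⁻¹ - R⁻¹ ≤ r⁻¹` ("since `w_{r,R}(x,y) ≤ r⁻¹`", §9);
* `integral_cutoffKernel` — `∫V_{r,R} = 4π(R² - r²)`;
* `backgroundK_cutoffKernel_le` — `sup_x ∫ w_{r,R}(x,y) dy ≤ ∫V_{r,R} ≤ 4πR²` (§5, proof of
  Lemma 5.3);
* `pairK_cutoffKernel_le` — `∑_{i<j} w_{r,R}(xᵢ,xⱼ) ≤ n² r⁻¹`;
* `fourier_cutoffKernel`, `fourier_cutoffKernel_nonneg`, `fourier_cutoffKernel_le` —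
  `𝓕V_{r,R}(p) = 4π(1/(4π²|p|² + R⁻²) - 1/(4π²|p|² + r⁻²)) ∈ [0, 4πR²]` (the kernel `w_{r,R}` is
  a nonnegative operator of norm `≤ sup 𝓕V ≤ 4πR²`, Lemma 5.4 proof; Mathlib's convention
  `𝓕f(p) = ∫e^{-2πi⟨x,p⟩}f`).

## References

* [LiebSolovej2001] E. H. Lieb, J. P. Solovej, Commun. Math. Phys. 217 (2001) 127–163, (4.2),
  proofs of Lemmas 5.3–5.4, §9 (arXiv:cond-mat/0007425, pp. 10–12, 23).
-/

noncomputable section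

open MeasureTheory Set Filter Real
open scoped ENNReal NNReal Topology FourierTransform InnerProductSpace

namespace Literature.MathematicalPhysics.QuantumManyBody.JelliumBoseGas

open BoseGas Coulomb

variable {n : ℕ}

/-! ### Pointwise bound -/

/-- `e^{-as} - e^{-bs} ≤ (b - a)s` for `0 ≤ a ≤ b`, `0 ≤ s`. [folklore] -/
theorem exp_neg_sub_exp_neg_le {a b s : ℝ} (ha : 0 ≤ a) (hab : a ≤ b) (hs : 0 ≤ s) :
    Real.exp (-(a * s)) - Real.exp (-(b * s)) ≤ (b - a) * s := by
  have h1 : Real.exp (-(a * s)) ≤ 1 := Real.exp_le_one_iff.2 (by nlinarith)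
  have h2 : 1 - Real.exp (-((b - a) * s)) ≤ (b - a) * s := by
    have := Real.add_one_le_exp (-((b - a) * s))
    linarith
  have e : Real.exp (-(b * s)) = Real.exp (-(a * s)) * Real.exp (-((b - a) * s)) := by
    rw [← Real.exp_add]; ring_nf
  have h3 : 0 ≤ 1 - Real.exp (-((b - a) * s)) :=
    sub_nonneg.2 (Real.exp_le_one_iff.2 (by nlinarith))
  calc Real.exp (-(a * s)) - Real.exp (-(b * s))
      = Real.exp (-(a * s)) * (1 - Real.exp (-((b - a) * s))) := by rw [e]; ring
    _ ≤ 1 * ((b - a) * s) := mul_le_mul h1 h2 h3 zero_le_one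
    _ = (b - a) * s := one_mul _

/-- **`V_{r,R} ≤ r⁻¹ - R⁻¹`** pointwise (`0 < r ≤ R`). [cite: LiebSolovej2001, (4.2)] -/
theorem cutoffKernel_le_inv_sub_inv {r R : ℝ} (hr : 0 < r) (hrR : r ≤ R) (x : Space) :
    cutoffKernel r R x ≤ r⁻¹ - R⁻¹ := by
  have hR : 0 < R := hr.trans_le hrR
  have hab : R⁻¹ ≤ r⁻¹ := (inv_le_inv₀ hR hr).2 hrR
  unfold cutoffKernel yukawa
  rw [div_sub_div_same]
  by_cases hx : x = 0
  · subst hx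
    simp only [norm_zero, div_zero, sub_nonneg]
    exact hab
  · have hxn : 0 < ‖x‖ := norm_pos_iff.2 hx
    rw [div_le_iff₀ hxn]
    exact exp_neg_sub_exp_neg_le (inv_nonneg.2 hR.le) hab hxn.le

/-- `V_{r,R} ≤ r⁻¹` ("`w_{r,R}(x,y) ≤ r⁻¹`"). [cite: LiebSolovej2001, §9] -/
theorem cutoffKernel_le_inv {r R : ℝ} (hr : 0 < r) (hrR : r ≤ R) (x : Space) :
    cutoffKernel r R x ≤ r⁻¹ :=
  (cutoffKernel_le_inv_sub_inv hr hrR x).trans (sub_le_self _ (inv_nonneg.2 (hr.le.trans hrR)))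

/-! ### Integral bounds -/

/-- **`∫ V_{r,R} = 4π(R² - r²)`**. [cite: LiebSolovej2001, §5 (proof of Lemma 5.3)] -/
theorem integral_cutoffKernel {r R : ℝ} (hr : 0 < r) (hR : 0 < R) :
    ∫ x, cutoffKernel r R x = 4 * π * R ^ 2 - 4 * π * r ^ 2 := by
  unfold cutoffKernel
  rw [integral_sub (integrable_yukawa' (inv_pos.2 hR)) (integrable_yukawa' (inv_pos.2 hr)),
    integral_yukawa (inv_pos.2 hR), integral_yukawa (inv_pos.2 hr), inv_pow, inv_pow,
    div_inv_eq_mul, div_inv_eq_mul]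

/-- **`sup_x ∫ w_{r,R}(x,y) dy ≤ 4πR²`**: for `0 ≤ θ ≤ 1`, `∫ θ(y)V_{r,R}(x-y) dy ≤ 4πR²`.
[cite: LiebSolovej2001, §5 (proof of Lemma 5.3)] -/
theorem backgroundK_cutoffKernel_le {θ : Space → ℝ} (hθ0 : ∀ x, 0 ≤ θ x) (hθ1 : ∀ x, θ x ≤ 1)
    {r R : ℝ} (hr : 0 < r) (hrR : r ≤ R) (x : Space) :
    backgroundK (cutoffKernel r R) θ x ≤ 4 * π * R ^ 2 := by
  have hR : 0 < R := hr.trans_le hrR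
  calc backgroundK (cutoffKernel r R) θ x ≤ ∫ y, cutoffKernel r R y :=
        backgroundK_le (cutoffKernel_nonneg hr hrR) (integrable_cutoffKernel hr hR) hθ0 hθ1 x
    _ = 4 * π * R ^ 2 - 4 * π * r ^ 2 := integral_cutoffKernel hr hR
    _ ≤ 4 * π * R ^ 2 := by nlinarith [Real.pi_pos, sq_nonneg r]

/-- `∑ⱼ ∫ w_{r,R}(xⱼ,y) dy ≤ 4π n R²`. [cite: LiebSolovej2001, §5] -/
theorem oneBodyK_cutoffKernel_le {θ : Space → ℝ} (hθ0 : ∀ x, 0 ≤ θ x) (hθ1 : ∀ x, θ x ≤ 1)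
    {r R : ℝ} (hr : 0 < r) (hrR : r ≤ R) (X : Config n) :
    oneBodyK (cutoffKernel r R) θ X ≤ n * (4 * π * R ^ 2) := by
  unfold oneBodyK
  calc ∑ j, θ (X j) * backgroundK (cutoffKernel r R) θ (X j) ≤ ∑ _j : Fin n, (1 : ℝ) * (4 * π * R ^ 2) :=
        Finset.sum_le_sum fun j _ => mul_le_mul (hθ1 _) (backgroundK_cutoffKernel_le hθ0 hθ1 hr hrR _)
          (backgroundK_nonneg (cutoffKernel_nonneg hr hrR) hθ0 _) zero_le_one
    _ = n * (4 * π * R ^ 2) := by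
        rw [Finset.sum_const, Finset.card_univ, Fintype.card_fin, nsmul_eq_mul, one_mul]

/-- **`∑_{i<j} w_{r,R}(xᵢ,xⱼ) ≤ n² r⁻¹`** (`0 ≤ θ ≤ 1`, `w_{r,R} ≤ r⁻¹`). [cite: LiebSolovej2001, §9] -/
theorem pairK_cutoffKernel_le {θ : Space → ℝ} (hθ0 : ∀ x, 0 ≤ θ x) (hθ1 : ∀ x, θ x ≤ 1)
    {r R : ℝ} (hr : 0 < r) (hrR : r ≤ R) (X : Config n) :
    pairK (cutoffKernel r R) θ X ≤ (n : ℝ) ^ 2 * r⁻¹ := by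
  have hterm : ∀ i j : Fin n, θ (X i) * cutoffKernel r R (X i - X j) * θ (X j) ≤ r⁻¹ := by
    intro i j
    calc θ (X i) * cutoffKernel r R (X i - X j) * θ (X j) ≤ 1 * r⁻¹ * 1 :=
          mul_le_mul (mul_le_mul (hθ1 _) (cutoffKernel_le_inv hr hrR _) (cutoffKernel_nonneg hr hrR _)
            zero_le_one) (hθ1 _) (hθ0 _) (by positivity)
      _ = r⁻¹ := by ring
  have hnn : ∀ i j : Fin n, 0 ≤ θ (X i) * cutoffKernel r R (X i - X j) * θ (X j) := fun i j =>
    mul_nonneg (mul_nonneg (hθ0 _) (cutoffKernel_nonneg hr hrR _)) (hθ0 _)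
  unfold pairK
  calc ∑ i, ∑ j with i < j, θ (X i) * cutoffKernel r R (X i - X j) * θ (X j)
      ≤ ∑ i, ∑ j, θ (X i) * cutoffKernel r R (X i - X j) * θ (X j) :=
        Finset.sum_le_sum fun i _ => Finset.sum_le_sum_of_subset_of_nonneg (Finset.filter_subset _ _)
          fun j _ _ => hnn i j
    _ ≤ ∑ _i : Fin n, ∑ _j : Fin n, r⁻¹ := Finset.sum_le_sum fun i _ => Finset.sum_le_sum fun j _ => hterm i j
    _ = (n : ℝ) ^ 2 * r⁻¹ := by
        simp only [Finset.sum_const, Finset.card_univ, Fintype.card_fin, nsmul_eq_mul]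
        ring

/-! ### The Fourier transform of `V_{r,R}` -/

/-- **`𝓕V_{r,R}(p) = 4π/(4π²|p|² + R⁻²) - 4π/(4π²|p|² + r⁻²)`** (Mathlib's convention).
[cite: LiebSolovej2001, §4 (after (4.2))] -/
theorem fourier_cutoffKernel {r R : ℝ} (hr : 0 < r) (hR : 0 < R) (p : Space) :
    𝓕 (fun x : Space => (cutoffKernel r R x : ℂ)) p =
      ((4 * π / (4 * π ^ 2 * ‖p‖ ^ 2 + (R⁻¹) ^ 2) - 4 * π / (4 * π ^ 2 * ‖p‖ ^ 2 + (r⁻¹) ^ 2) : ℝ) : ℂ) := by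
  have hR2 : 0 < (R⁻¹) ^ 2 := by positivity
  have hr2 : 0 < (r⁻¹) ^ 2 := by positivity
  have h1 := fourierIntegral_yukawa' hR2 p
  have h2 := fourierIntegral_yukawa' hr2 p
  rw [Real.sqrt_sq (inv_pos.2 hR).le] at h1
  rw [Real.sqrt_sq (inv_pos.2 hr).le] at h2
  rw [Real.fourier_eq] at h1 h2 ⊢
  have hI1 : Integrable fun v : Space => 𝐞 (-⟪v, p⟫_ℝ) •
      ((Real.exp (-(Real.sqrt ((R⁻¹) ^ 2) * ‖v‖)) / ‖v‖ : ℝ) : ℂ) :=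
    (Real.fourierIntegral_convergent_iff p).2 (integrable_yukawa hR2).ofReal
  have hI2 : Integrable fun v : Space => 𝐞 (-⟪v, p⟫_ℝ) •
      ((Real.exp (-(Real.sqrt ((r⁻¹) ^ 2) * ‖v‖)) / ‖v‖ : ℝ) : ℂ) :=
    (Real.fourierIntegral_convergent_iff p).2 (integrable_yukawa hr2).ofReal
  rw [Real.sqrt_sq (inv_pos.2 hR).le] at hI1
  rw [Real.sqrt_sq (inv_pos.2 hr).le] at hI2
  have e : ∀ v : Space, 𝐞 (-⟪v, p⟫_ℝ) • ((cutoffKernel r R v : ℝ) : ℂ) =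
      𝐞 (-⟪v, p⟫_ℝ) • ((Real.exp (-(R⁻¹ * ‖v‖)) / ‖v‖ : ℝ) : ℂ) -
        𝐞 (-⟪v, p⟫_ℝ) • ((Real.exp (-(r⁻¹ * ‖v‖)) / ‖v‖ : ℝ) : ℂ) := by
    intro v
    rw [← smul_sub, cutoffKernel, yukawa, yukawa]
    push_cast
    ring_nf
  simp_rw [e]
  rw [integral_sub hI1 hI2, h1, h2]
  push_cast
  ring

/-- **`𝓕V_{r,R} ≥ 0`** (`0 < r ≤ R`): `w_{r,R}` is a positive semi-definite kernel.
[cite: LiebSolovej2001, Lemma 5.4 (proof)] -/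
theorem fourier_cutoffKernel_nonneg {r R : ℝ} (hr : 0 < r) (hrR : r ≤ R) (p : Space) :
    0 ≤ 4 * π / (4 * π ^ 2 * ‖p‖ ^ 2 + (R⁻¹) ^ 2) - 4 * π / (4 * π ^ 2 * ‖p‖ ^ 2 + (r⁻¹) ^ 2) := by
  have hR : 0 < R := hr.trans_le hrR
  have hab : (R⁻¹) ^ 2 ≤ (r⁻¹) ^ 2 :=
    pow_le_pow_left₀ (inv_nonneg.2 hR.le) ((inv_le_inv₀ hR hr).2 hrR) 2
  have h0 : 0 < 4 * π ^ 2 * ‖p‖ ^ 2 + (R⁻¹) ^ 2 := by positivity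
  rw [sub_nonneg]
  exact div_le_div_of_nonneg_left (by positivity) h0 (by linarith)

/-- **`𝓕V_{r,R} ≤ 4πR²`**: the operator with kernel `w_{r,R}` has norm at most `4πR²`.
[cite: LiebSolovej2001, Lemma 5.4 (proof)] -/
theorem fourier_cutoffKernel_le {r R : ℝ} (hr : 0 < r) (hR : 0 < R) (p : Space) :
    4 * π / (4 * π ^ 2 * ‖p‖ ^ 2 + (R⁻¹) ^ 2) - 4 * π / (4 * π ^ 2 * ‖p‖ ^ 2 + (r⁻¹) ^ 2) ≤
      4 * π * R ^ 2 := by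
  have h1 : 4 * π / (4 * π ^ 2 * ‖p‖ ^ 2 + (R⁻¹) ^ 2) ≤ 4 * π / (R⁻¹) ^ 2 :=
    div_le_div_of_nonneg_left (by positivity) (by positivity) (by nlinarith [Real.pi_pos, sq_nonneg ‖p‖])
  have h2 : 0 ≤ 4 * π / (4 * π ^ 2 * ‖p‖ ^ 2 + (r⁻¹) ^ 2) := by positivity
  have e : 4 * π / (R⁻¹) ^ 2 = 4 * π * R ^ 2 := by rw [inv_pow, div_inv_eq_mul]
  linarith

end Literature.MathematicalPhysics.QuantumManyBody.JelliumBoseGas
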